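import Summits.AtomisticToContinuum.Crystallization.Theses.GappedShellCensus

/-!
# `Assembly` — glue for route `GappedShellCensus`
(item `stmt-AtomisticToContinuum-15934`, route rev 1)

The assembly item of route `GappedShellCensus` is the implication chain
`ShellCensus → RadialDefectsVanish → FiveFoldRationing → CleanLimitExtraction →
CleanLimitsHaveWindows → Crystallization`.
It is pure logic: it is literally the curried form of the route file's planner-authored,
sorry-free deciding theorem `Theses.GappedShellCensus.closes`, whose hypotheses are exactly the
five crux items (in the same order) and whose conclusion is `_root_.Crystallization`.  Inside
`closes` the proved tree theorems `PrestressSplitKorn.stub_hullCriterion` (hull criterion,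
stmt-3243), `windowOptimality_proof` (stmt-13962), `crysEnergyLimit_proof` (stmt-0626) and
`LennardJonesGroundStatesExist_holds` do the work; nothing analytic happens in this file — the
content of the route lives in the cruxes `ShellCensus`, `RadialDefectsVanish`, `FiveFoldRationing`,
`CleanLimitExtraction`, `CleanLimitsHaveWindows`.
-/

namespace Summit.AtomisticToContinuum.Crystallization.Theorems

open Summit.AtomisticToContinuum.Crystallization.Theses.GappedShellCensus

/-- **Assembly** (route `GappedShellCensus`, item stmt-AtomisticToContinuum-15934):
`ShellCensus → RadialDefectsVanish → FiveFoldRationing → CleanLimitExtraction →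
CleanLimitsHaveWindows → Crystallization`.
Proof: feed the five hypotheses, in order, to the route's deciding theorem
`Theses.GappedShellCensus.closes`. [folklore] -/
theorem gappedShellCensus_assembly_proof :
    Summit.AtomisticToContinuum.Crystallization.Theses.GappedShellCensus.Assembly := by
  unfold Theses.GappedShellCensus.Assembly
  intro hSC hRDV hFFR hCLE hCLHW
  exact closes hSC hRDV hFFR hCLE hCLHW

/-!
## Route rev 5 (item `stmt-AtomisticToContinuum-16776`)

After the refutation of the original crux `ShellCensus` (torn icosahedron,
`GappedShellCensusShellCensus_refuted`) the route was repaired (rev 5, 2026-08-17) and its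
assembly item restated as the SIX-hypothesis chain
`ShellTrichotomy → RadialDefectsVanish → TornFree → FiveFoldRationingR →
CleanLimitExtractionR → CleanLimitsHaveWindows → Crystallization`,
again literally the curried type of the (re-authored, sorry-free) deciding theorem
`Theses.GappedShellCensus.closes`.  The theorem above, written for the five-hypothesis rev-1
chain, still elaborates against rev 5 only because its partially applied `closes` happens to have
the right residual type; the theorem below is the properly named rev-5 glue and is the declaration
that closes item `stmt-AtomisticToContinuum-16776`.  As before nothing analytic happens here:
inside `closes`, `CleanLimitExtractionR` turns `RadialDefectsVanish`, `ShellTrichotomy`, `TornFree`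
and `FiveFoldRationingR` into `CleanLocalLimit`, `CleanLimitsHaveWindows` turns that into
`HullMinimality.PeriodicWindows`, and the proved tree theorems
`PrestressSplitKorn.stub_hullCriterion`, `windowOptimality_proof`, `crysEnergyLimit_proof` and
`LennardJonesGroundStatesExist_holds` deliver both Blanc–Lewin conjuncts.
-/

/-- **Assembly, route rev 5** (route `GappedShellCensus`, item stmt-AtomisticToContinuum-16776):
`ShellTrichotomy → RadialDefectsVanish → TornFree → FiveFoldRationingR →
CleanLimitExtractionR → CleanLimitsHaveWindows → Crystallization`.
Proof: introduce the six hypotheses and feed them, in the same order, to the route's deciding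
theorem `Theses.GappedShellCensus.closes`. [folklore] -/
theorem gappedShellCensus_assembly_rev5_proof :
    Summit.AtomisticToContinuum.Crystallization.Theses.GappedShellCensus.Assembly := by
  unfold Theses.GappedShellCensus.Assembly
  intro hST hRDV hTF hFFRR hCLER hCLHW
  exact closes hST hRDV hTF hFFRR hCLER hCLHW

end Summit.AtomisticToContinuum.Crystallization.Theorems
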